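import Literature.Computability.Cryptography.HallgrenClassGroup
import Literature.Computability.Complexity.BoolEncodings

/-!
# Stub `stub_fundDensityAP` of line `Sketch` (v2) for the crux `ArithStatLadder.IqThreeNotPPoly`

YES-density of the one-parameter arithmetic-progression family. For a squarefree modulus `N` of
bit length `n ≥ 3` and a seed `k < K := 2^(4n+8)` put `t = 1 + 2·N·k` and
`d = N·t·(27·N·t − 4)` (`= |Disc (x³ − x²y + N t y³)|`). Granting the elementary squarefree sieve
in an arithmetic progression (the antecedent, = the neighbour stub `stub_apSieve`), at least `K/8`
of the seeds make `−d` a negative fundamental discriminant.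

Mathematics.
* Sufficient condition, odd `N`: if `t` and `u := 27·N·t − 4` are squarefree then, with `m := N·t`
  (odd, squarefree since `t ≡ 1 (mod N)`), `d = m·(27m − 4)` is squarefree (`gcd(m, 27m−4) ∣ 4`,
  `m` odd) and `d ≡ 3 (mod 4)` (`m = 2j+1` gives `d = 4·(27j² + 25j + 5) + 3`): first branch of
  `IsNegFundamentalDiscr`.
* Sufficient condition, even `N = 2M` (`M` odd, squarefree): with `m := M·t`,
  `d = 4·m·(27m − 2)`; if `t` and `27·M·t − 2 = (27M − 2) + 108M²·k` are squarefree then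
  `m(27m−2)` is squarefree and `≡ 1 (mod 4)` (`= 4·(27j² + 26j + 6) + 1`), so `(−d)/4 ≡ 3 (mod 4)`:
  second branch.
* Counting: `K ≤ good + bad_t + bad_u`; the sieve at `(a, q, p₀) = (1, 2N, 3)` gives
  `2·bad_t ≤ K + 2√(1 + 2NK)`, at `(27N−4, 54N², 5)` resp. `(27M−2, 108M², 5)` gives
  `4·bad_u ≤ K + 4√(a + qK)`; with `N < 2^n`, `√(1+2NK) ≤ 2·2^(3n+4)`, `√(a+qK) ≤ 9·2^(3n+4)` and
  `128·2^(3n+4) ≤ K` for `n ≥ 3`, linear arithmetic gives `K ≤ 8·good`.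
-/

set_option linter.dupNamespace false -- D-0017: single-problem summit ⇒ `QuantumAdvantage.QuantumAdvantage` by design

namespace Summit.QuantumAdvantage.QuantumAdvantage.Theorems.IqThreeNotPPoly

open scoped Classical
open Finset
open _root_.Computability
open Literature.Computability.Cryptography (IsNegFundamentalDiscr)
open Literature.Computability.Complexity (bitsToNat_lt bitsToNat_encodeNat)

/-! ## Residues and coprimality -/

/-- For odd `M` and `c ∈ {2, 4}`: `gcd(M, 27M − c) = 1` (a common prime divides `c ∣ 4`, hence is
`2`, but `M` is odd). -/
theorem fundAP_coprime_sub {M c : ℕ} (hM : M % 2 = 1) (hc : c = 2 ∨ c = 4) :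
    Nat.Coprime M (27 * M - c) := by
  apply Nat.coprime_of_dvd
  intro p hp hpM hpu
  have h27 : p ∣ 27 * M := Dvd.dvd.mul_left hpM 27
  have hpc : p ∣ c := by
    have h := Nat.dvd_sub h27 hpu
    have e : 27 * M - (27 * M - c) = c := by omega
    rwa [e] at h
  have hp4 : p ∣ 2 ^ 2 := by
    rcases hc with rfl | rfl
    · exact hpc.trans (by norm_num)
    · simpa using hpc
  have hp2 : p = 2 := (Nat.prime_dvd_prime_iff_eq hp Nat.prime_two).1 (hp.dvd_of_dvd_pow hp4)
  subst hp2
  omega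

/-- For odd `M` and `c ∈ {2, 4}`: `gcd(27M − c, 108 M²) = 1` (`27M − c` is odd, `≢ 0 (mod 3)`, and
coprime to `M`). -/
theorem fundAP_coprime_mod {M c : ℕ} (hM : M % 2 = 1) (hc : c = 2 ∨ c = 4) :
    Nat.Coprime (27 * M - c) (108 * M ^ 2) := by
  have h2 : Nat.Coprime (27 * M - c) 2 :=
    ((Nat.Prime.coprime_iff_not_dvd Nat.prime_two).2 (by omega)).symm
  have h3 : Nat.Coprime (27 * M - c) 3 :=
    ((Nat.Prime.coprime_iff_not_dvd Nat.prime_three).2 (by omega)).symm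
  have hM' : Nat.Coprime (27 * M - c) M := (fundAP_coprime_sub hM hc).symm
  have e : 108 * M ^ 2 = 2 * 2 * 3 * 3 * 3 * (M * M) := by ring
  rw [e]
  exact ((((h2.mul_right h2).mul_right h3).mul_right h3).mul_right h3).mul_right (hM'.mul_right hM')

/-- A prime not dividing an even number is `≥ 3`. -/
theorem fundAP_three_le {p q : ℕ} (hp : p.Prime) (h2 : 2 ∣ q) (hn : ¬ p ∣ q) : 3 ≤ p := by
  by_contra h
  have h2p := hp.two_le
  interval_cases p
  exact hn h2

/-- A prime not dividing a multiple of `6` is `≥ 5`. -/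
theorem fundAP_five_le {p q : ℕ} (hp : p.Prime) (h6 : 6 ∣ q) (hn : ¬ p ∣ q) : 5 ≤ p := by
  by_contra h
  have h2p := hp.two_le
  interval_cases p
  · exact hn ((by norm_num : (2 : ℕ) ∣ 6).trans h6)
  · exact hn ((by norm_num : (3 : ℕ) ∣ 6).trans h6)
  · exact absurd hp (by norm_num)

/-! ## The sufficient conditions for fundamentality -/

/-- Odd core: for odd squarefree `m` with `27m − 4` squarefree, `−m(27m − 4)` is a negative
fundamental discriminant (`≡ 1 (mod 4)`, squarefree, `≠ 1`). -/
theorem fundAP_core_odd {m : ℕ} (hm2 : m % 2 = 1) (hm : Squarefree m)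
    (hu : Squarefree (27 * m - 4)) : IsNegFundamentalDiscr (m * (27 * m - 4)) := by
  have hsq : Squarefree (m * (27 * m - 4)) :=
    Nat.squarefree_mul_iff.2 ⟨fundAP_coprime_sub hm2 (Or.inr rfl), hm, hu⟩
  obtain ⟨c, hc⟩ : ∃ c, m * (27 * m - 4) = 4 * c + 3 := by
    obtain ⟨j, rfl⟩ : ∃ j, m = 2 * j + 1 := ⟨m / 2, by omega⟩
    refine ⟨27 * j ^ 2 + 25 * j + 5, ?_⟩
    have e : 27 * (2 * j + 1) - 4 = 54 * j + 23 := by omega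
    rw [e]
    ring
  rw [hc] at hsq ⊢
  left
  refine ⟨?_, ?_, ?_⟩
  · push_cast
    omega
  · rw [← Int.squarefree_natAbs, Int.natAbs_neg, Int.natAbs_natCast]
    exact hsq
  · omega

/-- Even core: for odd squarefree `m` with `27m − 2` squarefree, `−4m(27m − 2)` is a negative
fundamental discriminant (`4 ∣ −d`, `(−d)/4 = −m(27m−2) ≡ 3 (mod 4)`, squarefree). -/
theorem fundAP_core_even {m : ℕ} (hm2 : m % 2 = 1) (hm : Squarefree m)
    (hu : Squarefree (27 * m - 2)) : IsNegFundamentalDiscr (4 * (m * (27 * m - 2))) := by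
  have hsq : Squarefree (m * (27 * m - 2)) :=
    Nat.squarefree_mul_iff.2 ⟨fundAP_coprime_sub hm2 (Or.inl rfl), hm, hu⟩
  obtain ⟨c, hc⟩ : ∃ c, m * (27 * m - 2) = 4 * c + 1 := by
    obtain ⟨j, rfl⟩ : ∃ j, m = 2 * j + 1 := ⟨m / 2, by omega⟩
    refine ⟨27 * j ^ 2 + 26 * j + 6, ?_⟩
    have e : 27 * (2 * j + 1) - 2 = 54 * j + 25 := by omega
    rw [e]
    ring
  rw [hc] at hsq ⊢
  right
  have e : (-((4 * (4 * c + 1) : ℕ) : ℤ)) / 4 = -((4 * c + 1 : ℕ) : ℤ) := by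
    push_cast
    omega
  refine ⟨?_, ?_, ?_⟩
  · push_cast
    omega
  · rw [e]
    push_cast
    omega
  · rw [e, ← Int.squarefree_natAbs, Int.natAbs_neg, Int.natAbs_natCast]
    exact hsq

/-- Odd modulus: if `N` is odd and squarefree and both `t = 1 + 2Nk` and
`27Nt − 4 = (27N − 4) + 54N²k` are squarefree, then `−N t (27 N t − 4)` is a negative fundamental
discriminant. -/
theorem fundAP_fund_odd {N k : ℕ} (hN : Squarefree N) (hN2 : N % 2 = 1)
    (ht : Squarefree (1 + 2 * N * k)) (hu : Squarefree (27 * N - 4 + 54 * N ^ 2 * k)) :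
    IsNegFundamentalDiscr (N * (1 + 2 * N * k) * (27 * N * (1 + 2 * N * k) - 4)) := by
  rw [Nat.mul_assoc 27 N]
  have e : 27 * (N * (1 + 2 * N * k)) - 4 = 27 * N - 4 + 54 * N ^ 2 * k := by
    have h : 27 * (N * (1 + 2 * N * k)) = 27 * N + 54 * N ^ 2 * k := by ring
    omega
  rw [← e] at hu
  refine fundAP_core_odd ?_ (Nat.squarefree_mul_iff.2 ⟨?_, hN, ht⟩) hu
  · have h2 : (1 + 2 * N * k) % 2 = 1 := by
      have h : 2 * N * k = 2 * (N * k) := by ring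
      omega
    exact Nat.odd_iff.1 (Nat.odd_mul.2 ⟨Nat.odd_iff.2 hN2, Nat.odd_iff.2 h2⟩)
  · have h : 1 + 2 * N * k = 1 + N * (2 * k) := by ring
    rw [h]
    exact (Nat.coprime_add_mul_left_right N 1 (2 * k)).2 (Nat.coprime_one_right N)

/-- Even modulus `N = 2M`: if `M` is odd and squarefree and both `t = 1 + 2Nk` and
`27Mt − 2 = (27M − 2) + 108M²k` are squarefree, then `−N t (27 N t − 4) = −4·(M t)(27 M t − 2)` is
a negative fundamental discriminant. -/
theorem fundAP_fund_even {M k : ℕ} (hM : Squarefree M) (hM2 : M % 2 = 1)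
    (ht : Squarefree (1 + 2 * (2 * M) * k)) (hu : Squarefree (27 * M - 2 + 108 * M ^ 2 * k)) :
    IsNegFundamentalDiscr
      (2 * M * (1 + 2 * (2 * M) * k) * (27 * (2 * M) * (1 + 2 * (2 * M) * k) - 4)) := by
  have e1 : 2 * M * (1 + 2 * (2 * M) * k) * (27 * (2 * M) * (1 + 2 * (2 * M) * k) - 4)
      = 4 * (M * (1 + 2 * (2 * M) * k) * (27 * (M * (1 + 2 * (2 * M) * k)) - 2)) := by
    generalize 1 + 2 * (2 * M) * k = t
    have h54 : 27 * (2 * M) * t - 4 = 2 * (27 * (M * t) - 2) := by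
      have h : 27 * (2 * M) * t = 2 * (27 * (M * t)) := by ring
      omega
    rw [h54]
    generalize 27 * (M * t) - 2 = u
    ring
  rw [e1]
  have e2 : 27 * (M * (1 + 2 * (2 * M) * k)) - 2 = 27 * M - 2 + 108 * M ^ 2 * k := by
    have h : 27 * (M * (1 + 2 * (2 * M) * k)) = 27 * M + 108 * M ^ 2 * k := by ring
    omega
  rw [← e2] at hu
  refine fundAP_core_even ?_ (Nat.squarefree_mul_iff.2 ⟨?_, hM, ht⟩) hu
  · have h2 : (1 + 2 * (2 * M) * k) % 2 = 1 := by
      have h : 2 * (2 * M) * k = 2 * (2 * M * k) := by ring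
      omega
    exact Nat.odd_iff.1 (Nat.odd_mul.2 ⟨Nat.odd_iff.2 hM2, Nat.odd_iff.2 h2⟩)
  · have h : 1 + 2 * (2 * M) * k = 1 + M * (4 * k) := by ring
    rw [h]
    exact (Nat.coprime_add_mul_left_right M 1 (4 * k)).2 (Nat.coprime_one_right M)

/-! ## Counting -/

/-- Covering bound: if `A k ∧ B k → P k` then `range K ⊆ {P} ∪ {¬A} ∪ {¬B}`, so
`K ≤ #{P} + #{¬A} + #{¬B}`. -/
theorem fundAP_le_card_add {K : ℕ} {P A B : ℕ → Prop} [DecidablePred P] [DecidablePred A]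
    [DecidablePred B] (h : ∀ k, A k → B k → P k) :
    K ≤ ((Finset.range K).filter P).card + ((Finset.range K).filter (fun k => ¬ A k)).card +
      ((Finset.range K).filter (fun k => ¬ B k)).card := by
  calc K = (Finset.range K).card := (Finset.card_range K).symm
    _ ≤ ((Finset.range K).filter P ∪ (Finset.range K).filter (fun k => ¬ A k) ∪
          (Finset.range K).filter (fun k => ¬ B k)).card := by
        apply Finset.card_le_card
        intro k hk
        simp only [Finset.mem_union, Finset.mem_filter]
        by_cases hA : A k
        · by_cases hB : B k
          · exact Or.inl (Or.inl ⟨hk, h k hA hB⟩)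
          · exact Or.inr ⟨hk, hB⟩
        · exact Or.inl (Or.inr ⟨hk, hA⟩)
    _ ≤ _ := (Finset.card_union_le _ _).trans
          (Nat.add_le_add_right (Finset.card_union_le _ _) _)

/-- Square-root bookkeeping: `x ≤ c²·N²·2^(4n+8)` and `N ≤ 2^n` give `√x ≤ c·2^(3n+4)`. -/
theorem fundAP_sqrt_le {x c N n : ℕ} (hN : N ≤ 2 ^ n)
    (hx : x ≤ c ^ 2 * (N ^ 2 * 2 ^ (4 * n + 8))) : Nat.sqrt x ≤ c * 2 ^ (3 * n + 4) := by
  rw [← Nat.sqrt_eq' (c * 2 ^ (3 * n + 4))]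
  apply Nat.sqrt_le_sqrt
  calc x ≤ c ^ 2 * (N ^ 2 * 2 ^ (4 * n + 8)) := hx
    _ ≤ c ^ 2 * ((2 ^ n) ^ 2 * 2 ^ (4 * n + 8)) :=
        Nat.mul_le_mul_left _ (Nat.mul_le_mul_right _ (Nat.pow_le_pow_left hN 2))
    _ = (c * 2 ^ (3 * n + 4)) ^ 2 := by ring

/-- The density core: the AP sieve (hypothesis `hS`) at `(1, 2N, 3)` and at `(a, q, 5)`, a
sufficient condition `Squarefree (1 + 2Nk) ∧ Squarefree (a + qk) → −d_k fundamental`, and the size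
bound `a + qK ≤ 81 N² K` give `K ≤ 8 · #{k < K : −d_k fundamental}` for `K = 2^(4n+8)`,
`N < 2^n`, `n ≥ 3`. -/
theorem fundAP_density_core
    (hS : ∀ (a q K p₀ : ℕ), 0 < q → Nat.Coprime a q → 2 ≤ p₀ →
      (∀ p : ℕ, p.Prime → ¬ p ∣ q → p₀ ≤ p) →
        (p₀ - 1) * ((Finset.range K).filter (fun k => ¬ Squarefree (a + q * k))).card ≤
          K + (p₀ - 1) * Nat.sqrt (a + q * K))
    {n N a q : ℕ} (hn : 3 ≤ n) (hN1 : 1 ≤ N) (hN : N < 2 ^ n) (hq : 0 < q)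
    (hcop : Nat.Coprime a q) (hp : ∀ p : ℕ, p.Prime → ¬ p ∣ q → 5 ≤ p)
    (hsize : a + q * 2 ^ (4 * n + 8) ≤ 81 * (N ^ 2 * 2 ^ (4 * n + 8)))
    (himp : ∀ k, Squarefree (1 + 2 * N * k) → Squarefree (a + q * k) →
      IsNegFundamentalDiscr (N * (1 + 2 * N * k) * (27 * N * (1 + 2 * N * k) - 4))) :
    2 ^ (4 * n + 8) ≤ 8 * ((Finset.range (2 ^ (4 * n + 8))).filter (fun k =>
      IsNegFundamentalDiscr (N * (1 + 2 * N * k) * (27 * N * (1 + 2 * N * k) - 4)))).card := by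
  have hX : 128 * 2 ^ (3 * n + 4) ≤ 2 ^ (4 * n + 8) := by
    rw [show 4 * n + 8 = (n + 4) + (3 * n + 4) by ring, pow_add 2 (n + 4) (3 * n + 4)]
    apply Nat.mul_le_mul_right
    calc 128 = 2 ^ 7 := by norm_num
      _ ≤ 2 ^ (n + 4) := Nat.pow_le_pow_right (by norm_num) (by omega)
  have hK1 : 1 ≤ 2 ^ (4 * n + 8) := Nat.one_le_two_pow
  have hNK : N ≤ N ^ 2 * 2 ^ (4 * n + 8) :=
    (Nat.le_self_pow two_ne_zero N).trans (Nat.le_mul_of_pos_right _ hK1)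
  -- the two sieve instances
  have h1 : 2 * ((Finset.range (2 ^ (4 * n + 8))).filter
        (fun k => ¬ Squarefree (1 + 2 * N * k))).card ≤
      2 ^ (4 * n + 8) + 2 * Nat.sqrt (1 + 2 * N * 2 ^ (4 * n + 8)) :=
    hS 1 (2 * N) (2 ^ (4 * n + 8)) 3 (by omega) (Nat.coprime_one_left _) (by norm_num)
      (fun p hp hpn => fundAP_three_le hp (dvd_mul_right 2 N) hpn)
  have h2 : 4 * ((Finset.range (2 ^ (4 * n + 8))).filter
        (fun k => ¬ Squarefree (a + q * k))).card ≤
      2 ^ (4 * n + 8) + 4 * Nat.sqrt (a + q * 2 ^ (4 * n + 8)) :=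
    hS a q (2 ^ (4 * n + 8)) 5 hq hcop (by norm_num) hp
  -- covering
  have h3 : 2 ^ (4 * n + 8) ≤ ((Finset.range (2 ^ (4 * n + 8))).filter (fun k =>
        IsNegFundamentalDiscr (N * (1 + 2 * N * k) * (27 * N * (1 + 2 * N * k) - 4)))).card +
      ((Finset.range (2 ^ (4 * n + 8))).filter (fun k => ¬ Squarefree (1 + 2 * N * k))).card +
      ((Finset.range (2 ^ (4 * n + 8))).filter (fun k => ¬ Squarefree (a + q * k))).card :=
    fundAP_le_card_add himp
  -- sizes
  have hs1 : Nat.sqrt (1 + 2 * N * 2 ^ (4 * n + 8)) ≤ 2 * 2 ^ (3 * n + 4) := by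
    refine fundAP_sqrt_le hN.le ?_
    have h : N * 2 ^ (4 * n + 8) ≤ N ^ 2 * 2 ^ (4 * n + 8) :=
      Nat.mul_le_mul_right _ (Nat.le_self_pow two_ne_zero N)
    have e : 2 * N * 2 ^ (4 * n + 8) = 2 * (N * 2 ^ (4 * n + 8)) := by ring
    rw [e]
    omega
  have hs2 : Nat.sqrt (a + q * 2 ^ (4 * n + 8)) ≤ 9 * 2 ^ (3 * n + 4) :=
    fundAP_sqrt_le hN.le (by simpa using hsize)
  omega

/-- **Stub G′ · `stub_fundDensityAP`.** Granting the elementary squarefree sieve in arithmetic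
progressions (the antecedent), for every squarefree `N` of bit length `n ≥ 3` at least one eighth
of the seeds `k < 2^(4n+8)` make `−N t (27 N t − 4)`, `t = 1 + 2Nk`, a negative fundamental
discriminant (odd `N`: sieve at `(1, 2N, 3)` and `(27N − 4, 54N², 5)`; even `N = 2M`: at
`(1, 2N, 3)` and `(27M − 2, 108M², 5)`). -/
theorem stub_fundDensityAP :
    (∀ (a q K p₀ : ℕ), 0 < q → Nat.Coprime a q → 2 ≤ p₀ →
      (∀ p : ℕ, p.Prime → ¬ p ∣ q → p₀ ≤ p) →
        (p₀ - 1) * ((Finset.range K).filter (fun k => ¬ Squarefree (a + q * k))).card ≤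
          K + (p₀ - 1) * Nat.sqrt (a + q * K)) →
    ∃ n₀ : ℕ, ∀ n, n₀ ≤ n → ∀ N : ℕ, Squarefree N → (encodeNat N).length = n →
      2 ^ (4 * n + 8) ≤ 8 * ((Finset.range (2 ^ (4 * n + 8))).filter (fun k =>
        IsNegFundamentalDiscr (N * (1 + 2 * N * k) * (27 * N * (1 + 2 * N * k) - 4)))).card := by
  intro hS
  refine ⟨3, fun n hn N hN hlen => ?_⟩
  have hNlt : N < 2 ^ n := by
    have h := bitsToNat_lt (encodeNat N)
    rwa [bitsToNat_encodeNat, hlen] at h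
  have h4 : ¬ 4 ∣ N := fun h => absurd (Nat.isUnit_iff.1 (hN 2 h)) (by norm_num)
  have hN0 : N ≠ 0 := fun h => not_squarefree_zero (h ▸ hN)
  have hKpos : 1 ≤ 2 ^ (4 * n + 8) := Nat.one_le_two_pow
  obtain ⟨M, hM | hM⟩ := Nat.even_or_odd' N
  · -- even modulus `N = 2M`, `M` odd and squarefree
    subst hM
    have hM2 : M % 2 = 1 := by omega
    have hMsq : Squarefree M := hN.squarefree_of_dvd (dvd_mul_left M 2)
    have hM0 : 0 < M := by omega
    refine fundAP_density_core hS hn (by omega) hNlt (a := 27 * M - 2) (q := 108 * M ^ 2)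
      (by positivity) (fundAP_coprime_mod hM2 (Or.inl rfl))
      (fun p hp hpn => fundAP_five_le hp (Dvd.intro (18 * M ^ 2) (by ring)) hpn) ?_
      (fun k ht hu => fundAP_fund_even hMsq hM2 ht hu)
    have hMK : M ≤ M ^ 2 * 2 ^ (4 * n + 8) :=
      (Nat.le_self_pow two_ne_zero M).trans (Nat.le_mul_of_pos_right _ hKpos)
    have e1 : 108 * M ^ 2 * 2 ^ (4 * n + 8) = 108 * (M ^ 2 * 2 ^ (4 * n + 8)) := by ring
    have e2 : 81 * ((2 * M) ^ 2 * 2 ^ (4 * n + 8)) = 324 * (M ^ 2 * 2 ^ (4 * n + 8)) := by ring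
    rw [e1, e2]
    omega
  · -- odd modulus
    have hN2 : N % 2 = 1 := by omega
    refine fundAP_density_core hS hn (by omega) hNlt (a := 27 * N - 4) (q := 54 * N ^ 2)
      (by positivity)
      ((fundAP_coprime_mod hN2 (Or.inr rfl)).coprime_dvd_right (Dvd.intro 2 (by ring)))
      (fun p hp hpn => fundAP_five_le hp (Dvd.intro (9 * N ^ 2) (by ring)) hpn) ?_
      (fun k ht hu => fundAP_fund_odd hN hN2 ht hu)
    have hNK : N ≤ N ^ 2 * 2 ^ (4 * n + 8) :=
      (Nat.le_self_pow two_ne_zero N).trans (Nat.le_mul_of_pos_right _ hKpos)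
    have e1 : 54 * N ^ 2 * 2 ^ (4 * n + 8) = 54 * (N ^ 2 * 2 ^ (4 * n + 8)) := by ring
    rw [e1]
    omega

end Summit.QuantumAdvantage.QuantumAdvantage.Theorems.IqThreeNotPPoly
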